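import Summits.ABC.IUTFork.Joshi.LogLinkFrobeniusTransport

/-!
# [J-IIp] Thm. 10.15.1 (3), the FIXED-IDENTIFICATIONS reading: «the composite of the §10.14 identifications
# `K_{y_{n−1}} ≃ K_{x_can} ≃ K_{y_n}` cannot be inserted» is EQUIVALENT, under §10.13 + §10.5, to «the identifications are not
# the ϕ-transport» (`¬ FrobCompatible`) — kernel form of the reading question of abc-iut-E-t40 (located, not adjudicated)

Proof-only companion (abc-iut cell, block E, rung LADDER-ABC:A2.E; seat abc-iut-E-t7 gen 2, author of `Joshi/LogLinkFrobeniusTransport.lean`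
p430819 / `Joshi/LogLinkInsertedIso.lean` p436476 / `Joshi/LogLinkInsertedIsometry.lean` p437232) answering the READING QUESTION handed to
E-ref-2 by the typer-side read of p436476 (abc-iut-E-t40 2026-08-26T10:14:02Z: «if (3) means τ must commute with the FIXED §10.14
identifications, it says they are not ϕ-transported (¬FrobCompatible), which is consistent»). Source: K. Joshi, arXiv:2303.01662v3
(`paper:arxiv-2303.01662`; bib `Joshi2023ATS2Local`; unrefereed — TYPED AS A CANDIDATE), Thm. 10.15.1 (3) p.33 l.66–68, §10.13 p.33 l.1–12,
§10.14 p.33 l.13–17, §10.5 p.31 l.40–45. TAKES NO SIDE on [IUTchIII] Cor. 3.12 or on any author; typed ≠ proved; located ≠ adjudicated.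
Object-side (R14-clean); 0 `def`s; no FACT-LIST row; nothing asserted.

THE THREE READINGS OF (3), by decl name (p430819 vocabulary: a common target `I = (iso₀ : K_y ≃ C, iso₁ : K_{ϕ(y)} ≃ C)`, `log₀ = iso₀ ∘ η_y`,
`log₁ = iso₁ ∘ η_{ϕ(y)}`; a §10.13 transport `T` with `σ_y = T.residueIso`):
* (∃-reading) `NoInsertedIso I`: NO automorphism `τ` of `C` can be inserted — FALSE at every transport point, for every `I` (p436476
  `not_noInsertedIso_of_transport`), even isometrically (p437232);
* (R-fix) `LogsCoincide I`: the two logarithms are the same map — contradicts the transport given «log hits 1» (p436476);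
* (FIXED reading, this file) «the IDENTITY of `C` cannot be inserted», i.e. `¬ ∀ b ∈ B^{φ=p}, log₀ b = log₁ (ϕ b)`: the squares do not
  commute with the given identifications and no extra map. KERNEL: at a transport point this is EQUIVALENT to `¬ FrobCompatible T I`
  restricted to the log-shell (`idInserted_iff_frobCompatibleOnLogs`), and to `¬ FrobCompatible T I` outright when `η_y` maps `B^{φ=p}`
  onto `K_y` (§10.5 surjectivity; `idInserted_iff_frobCompatible`). So in the fixed reading (3) is CONSISTENT with §10.13 and SAYS
  EXACTLY: «the §10.14 identifications `K_{y_n} ≃ K_{x_can}` are not the isomorphisms induced by `ϕ`». Whether the [FF18, Thm. 6.5.2 (5)]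
  identifications through `X = Y/ϕ^ℤ` are or are not the ϕ-transport is the residual faithfulness question (E-ref-2), recorded here by
  decl name (`FrobCompatible`), not adjudicated.
-/

noncomputable section

namespace Summit.ABC.IUTFork.Joshi

namespace PeriodRingDatum

variable {F B E0 : Type} [Field F] [CommRing B] [Field E0] {Y : Type} {K : Y → Type} [∀ y, Field (K y)] {G : Type}
  {D : PeriodRingDatum F B E0 Y K G} {C : Type} [Field C] {y : Y}

/-- (R-ϕ) ⟹ the identity is inserted: with ϕ-transported identifications every square commutes with NO extra map
(`log₁ (ϕ b) = iso₁ (σ_y (η_y b)) = iso₀ (η_y b) = log₀ b`, on all of `B`). [claim: Joshi2023ATS2Local, status: disputed] -/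
theorem idInserted_of_frobCompatible (T : D.FrobeniusTransport y) (I : D.CommonTarget C y) (hI : FrobCompatible T I) (b : B) :
    I.log₀ b = I.log₁ (D.frob b) := by
  show I.iso₀ (D.eta y b) = I.iso₁ (D.eta (D.frobY y) (D.frob b))
  rw [← T.residueIso_eta b, hI]

/-- Conversely, if the identity is inserted then the identifications ARE the ϕ-transport on the log-shell `η_y(B^{φ=p})`:
`iso₁ (σ_y (η_y b)) = iso₀ (η_y b)` for `b ∈ B^{φ=p}`. [claim: Joshi2023ATS2Local, status: disputed] -/
theorem frobCompatibleOnLogs_of_idInserted (T : D.FrobeniusTransport y) (I : D.CommonTarget C y)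
    (h : ∀ b ∈ D.Bphi, I.log₀ b = I.log₁ (D.frob b)) {b : B} (hb : b ∈ D.Bphi) :
    I.iso₁ (T.residueIso (D.eta y b)) = I.iso₀ (D.eta y b) := by
  rw [T.residueIso_eta b]
  exact (h b hb).symm

/-- **The FIXED reading of (3) on the log-shell**: «the identity of `C` is NOT inserted» ⟺ «the identifications are NOT the ϕ-transport
on `η_y(B^{φ=p})`». [claim: Joshi2023ATS2Local, status: disputed] -/
theorem idInserted_iff_frobCompatibleOnLogs (T : D.FrobeniusTransport y) (I : D.CommonTarget C y) :
    (∀ b ∈ D.Bphi, I.log₀ b = I.log₁ (D.frob b)) ↔ ∀ b ∈ D.Bphi, I.iso₁ (T.residueIso (D.eta y b)) = I.iso₀ (D.eta y b) := by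
  refine ⟨fun h b hb => frobCompatibleOnLogs_of_idInserted T I h hb, fun h b hb => ?_⟩
  show I.iso₀ (D.eta y b) = I.iso₁ (D.eta (D.frobY y) (D.frob b))
  rw [← T.residueIso_eta b, h b hb]

/-- **The FIXED reading of (3), with §10.5's surjectivity** («the canonical surjection `η_{K_y}` … restricted to `B^{φ=p}` is the
logarithm, surjective onto `K_y`», p.31 l.40–45 — here as the explicit hypothesis `hsurj`): «the identity of `C` is NOT inserted» ⟺
`¬ FrobCompatible T I` — (3) says exactly that the §10.14 identifications are not the isomorphisms induced by `ϕ`. Consistent with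
§10.13 (no contradiction either way over the signature). Located, not adjudicated. [claim: Joshi2023ATS2Local, status: disputed] -/
theorem idInserted_iff_frobCompatible (T : D.FrobeniusTransport y) (I : D.CommonTarget C y)
    (hsurj : ∀ k : K y, ∃ b ∈ D.Bphi, D.eta y b = k) :
    (∀ b ∈ D.Bphi, I.log₀ b = I.log₁ (D.frob b)) ↔ FrobCompatible T I := by
  refine ⟨fun h k => ?_, fun hI b _ => idInserted_of_frobCompatible T I hI b⟩
  obtain ⟨b, hb, rfl⟩ := hsurj k
  exact frobCompatibleOnLogs_of_idInserted T I h hb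

/-- Negated form, as print states (3): «no [identity-]isomorphism may be inserted» ⟺ «the identifications are not ϕ-transported».
[claim: Joshi2023ATS2Local, status: disputed] -/
theorem not_idInserted_iff_not_frobCompatible (T : D.FrobeniusTransport y) (I : D.CommonTarget C y)
    (hsurj : ∀ k : K y, ∃ b ∈ D.Bphi, D.eta y b = k) :
    (¬ ∀ b ∈ D.Bphi, I.log₀ b = I.log₁ (D.frob b)) ↔ ¬ FrobCompatible T I :=
  not_congr (idInserted_iff_frobCompatible T I hsurj)

/-- And in the fixed reading Thm. 10.15.1 (4) is unaffected: it holds whenever `log₁` is onto `C` (p430819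
`logShellStep_of_log₁_surjective`) and whenever the identifications ARE the transport (`logShellStep_of_frobCompatible`); recorded
here only as the pointer that (4) does not discriminate between the readings. [claim: Joshi2023ATS2Local, status: disputed] -/
theorem logShellStep_of_idInserted (T : D.FrobeniusTransport y) (I : D.CommonTarget C y)
    (hsurj : ∀ k : K y, ∃ b ∈ D.Bphi, D.eta y b = k) (h : ∀ b ∈ D.Bphi, I.log₀ b = I.log₁ (D.frob b)) :
    LogShellStep I :=
  D.logShellStep_of_frobCompatible T I ((idInserted_iff_frobCompatible T I hsurj).1 h)

end PeriodRingDatum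

end Summit.ABC.IUTFork.Joshi

end
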